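import Summits.ABC.IUTFork.Cor312GenuineKWildExactTriple
import Summits.ABC.IUTFork.Cor312GenuineKWildDifferentUpper
import Summits.ABC.IUTFork.Conditional.AbcOfSGenuineKLinUniform
import HarnessLib

/-!
# Branch C / R-W lane «uniform lemma»: the [LIN] explicit-depth refutation made UNIFORM IN THE LOCAL TYPE at the WILD pole primes
# `p ∈ {3, 5}` — `d + a + b ≤ B + 2 + 1/(p−2) − 1/e` at EVERY place over `p` (`p·p′·l < p^B`), hence unconditional per-datum refutations

PROOF-ONLY file (no `def`, no new `Prop`, no instance) of the abc-iut cell (WAVE-5 prover seat abc-iut-w5-d180, gen 10; R-W row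
«W:HENSEL-DIFFERENT-LOCAL», file 3/3). TAKES NO SIDE on [IUTchIII] Cor. 3.12 or on any author. NO new engine: the per-datum [LIN] socket
`GenuineK.not_pilotKummerCompatHull_chosen_of_explicit_depth` (abc-iut-C-cert-1, p438886: `p^{((i+2)(d+a+b))+1}·‖t_q(x₀)‖^{(i+1)²−1} < 1 ⇒ ¬S_H`)
is fed — exactly as in abc-iut-w5-d107's TAME sibling `GenuineK.not_pilotKummerCompatHull_chosen_ratPoint_of_linUniform` (`p ∉ {2,3,5,l}`,
`AbcOfSGenuineKLinUniform`) — with a bound on the [IUTchIV] Prop. 1.1/1.2 constants `d, a, b` of `K_{x₀}` holding for EVERY local type at a pole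
`p ∈ {3, 5}`: this seat's `GenuineK.depthConstants_kOf_le_wild_ratPoint` (`p·p′·l < p^B ⇒ d + a + b ≤ B + 2 + 1/(p−2) − 1/e`; Dedekind–Hensel
`d ≤ 1 − 1/e + v_p(e)` read at the genuine completion, `DifferentOrdHenselBound` / `Cor312GenuineKWildDifferentUpper`, with `v_p(e) ≤ 1` and
`e ≤ p(p−1)·p′·l` from abc-iut-W-neg-1's exact wild local types). The wild term costs exactly `1` against the tame budget `B + 1 + 1/(p−2) − 1/e`.

* `GenuineK.not_pilotKummerCompatHull_chosen_ratPoint_of_linUniform_wild` — `λ ∈ ℚ`, `T` at `(ratPoint λ, l)`, `{p, p′} = {3, 5}`, `p ≠ l`,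
  a pole of `j(λ)` of order EXACTLY `2t > 0` at `p`, `B` with `p·p′·l < p^B`, a label `i₀ + 1 ≤ l⋆` with the INTEGER TEST
  **`2l·((i₀+2)·((B+2)(p−2)+1) + (p−2)) ≤ 2t·i₀(i₀+2)·(p−2)`** ⇒ ¬ S_H at EVERY genuine Θ-volume datum over `(ratPoint λ, l)` — NO hypothesis
  on the local type (W1 / W2 / split alike);
* `GenuineK.not_pilotKummerCompatHull_chosen_triple_of_linUniform_wild` — abc-TRIPLE form (`λ = a/c`, `p^v ∥ abc`, `t = v`, via abc-iut-W-neg-1's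
  `RadTriple.ord_jInv_eq_neg_two_mul`).

HONEST SCOPE as in the tame sibling: SHARP reading (Θ-possible-image set constant in `m`, typed (Ind1)/(Ind2) = Dupuy–Hilado families); per-label
licence STRONGER than print; admissibility / Szpiro-badness / (P6) / non-emptiness of the datum type NOT claimed; «refuted as typed» ≠ «refuted in
print»; nothing about the number-level Corollary; typed ≠ proved; instantiated ≠ endorsed; no abc claim.
[cite: Mochizuki2012, IUTchIII Cor. 3.12 Step (xi-f) p. 184; IUTchIV Prop. 1.1 p. 9, Prop. 1.2 p. 10, Cor. 2.2 (ii) proof p. 44–46]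
[cite: SerreLocalFields1979, Ch. III §6 Prop. 13 and Remark] [cite: NeukirchANT1999, Ch. III (2.6)] [cite: MochizukiGenEll2010, Thm. 2.1 p. 11]
[claim: Mochizuki2012, status: disputed] for every IUT sentence quoted.
-/

noncomputable section

open Set Function NumberField IsDedekindDomain

namespace Summit.ABC.IUTFork.Conditional

open Thm311 Thm311.Real Cor312 Cor312Vol Cor312Prov Literature.IUT.LogThetaLattice Literature.IUT.LogVolume
  Literature.IUT.HodgeTheaters Literature.IUT.LogVolume.ThetaData Literature.IUT.LogVolume.Cor22
open Literature.NumberTheory.NumberFields Literature.NumberTheory.GaloisRepresentations.Ultrametric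
open Literature.NumberTheory.DiophantineGeometry Literature.NumberTheory.DiophantineGeometry.GenEll Summit.ABC.ABC.Theorems

/-- **UNCONDITIONAL [LIN] REFUTATION AT A RATIONAL POINT, UNIFORM IN THE LOCAL TYPE, AT A WILD POLE PRIME `p ∈ {3, 5}`.** `λ ∈ ℚ`, `T` a genuine
Θ-volume datum at `(ratPoint λ, l)`, `{p, p′} = {3, 5}`, `p ≠ l`, a pole of `j(λ)` at `p` of order exactly `2t > 0`, `B : ℕ` with `p·p′·l < p^B`,
a label `j = i₀+1 ≤ l⋆` with the integer test **`2l·((i₀+2)·((B+2)(p−2)+1) + (p−2)) ≤ 2t·i₀(i₀+2)·(p−2)`**. THEN the hull-level clause S_H (chosen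
realising ideles, pinned reading) FAILS for every choice of the free context binders and Kummer datum: at any `x₀ | p` (bad,
`‖t_q(x₀)‖ ≤ p^{−2t/(2l)}` — abc-iut-w4-d026) the WILD-uniform budget `d + a + b ≤ B + 2 + 1/(p−2) − 1/e`
(`GenuineK.depthConstants_kOf_le_wild_ratPoint`: Hensel `d ≤ 2 − 1/e`, `e ≤ p(p−1)p′l`) makes `p^{((i₀+2)(d+a+b))+1}·‖t_q(x₀)‖^{(i₀+1)²−1} < 1`, and
abc-iut-C-cert-1's p438886 fires. [cite: Mochizuki2012, IUTchIV Prop. 1.2 p. 10, Cor. 2.2 (ii) proof (P5) p. 46; IUTchIII Cor. 3.12 Step (xi-f) p. 184]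
[cite: SerreLocalFields1979, Ch. III §6 Prop. 13 and Remark] [claim: Mochizuki2012, status: disputed] -/
theorem GenuineK.not_pilotKummerCompatHull_chosen_ratPoint_of_linUniform_wild {q : ℚ} {l : ℕ}
    (T : Cor22.ThetaVolumeDatumAt (ratPoint q) l) (pp : Nat.Primes) {p' : ℕ}
    (hpq : ((pp : ℕ) = 3 ∧ p' = 5) ∨ ((pp : ℕ) = 5 ∧ p' = 3)) (hpl : (pp : ℕ) ≠ l)
    (B : ℕ) (hB : (pp : ℕ) * p' * l < (pp : ℕ) ^ B) {t : ℕ} (ht : 0 < t)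
    (hpole : ∀ u : HeightOneSpectrum (𝓞 ℚ), Rat.HeightOneSpectrum.natGenerator u = (pp : ℕ) →
      ord ℚ u (Cor22.jInv q) = -(2 * (t : ℤ)))
    (i₀ : ℕ) (hil : i₀ + 1 ≤ (l - 1) / 2)
    (htest : 2 * l * ((i₀ + 2) * ((B + 2) * ((pp : ℕ) - 2) + 1) + ((pp : ℕ) - 2)) ≤ 2 * t * (i₀ * (i₀ + 2)) * ((pp : ℕ) - 2)) :
    letI := T.instFieldF; letI := T.instNumberFieldF; letI := T.instAlgebraF; letI := T.instFieldK
    letI := T.instNumberFieldK; letI := T.instAlgebraK; letI := T.instFieldFbar; letI := T.instAlgebraFbar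
    letI := T.instAlgebraKFbar; letI := T.instIsElliptic
    haveI : Fact (pp : ℕ).Prime := ⟨pp.2⟩
    ∀ (M : Type) [Field M] [NumberField M]
      (archPk : ∀ (j : (thetaIndex (pilotDataOfK T.D T.K)).Label) (vQ : (thetaIndex (pilotDataOfK T.D T.K)).VQ),
        Set ((logShellsDH (pilotDataOfK T.D T.K) (analyticLogv T.K)).Packet j vQ))
      (archSub : ∀ (j : (thetaIndex (pilotDataOfK T.D T.K)).Label) (v : (thetaIndex (pilotDataOfK T.D T.K)).V),
        Set ((logShellsDH (pilotDataOfK T.D T.K) (analyticLogv T.K)).Packet j ((thetaIndex (pilotDataOfK T.D T.K)).over v)))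
      (Ψ : ℤ → ∀ v : (thetaIndex (pilotDataOfK T.D T.K)).V, v ∈ (thetaIndex (pilotDataOfK T.D T.K)).Vbad →
        Set ((logShellsDH (pilotDataOfK T.D T.K) (analyticLogv T.K)).StarPacket v))
      (act : ℤ → ∀ v : (thetaIndex (pilotDataOfK T.D T.K)).V, v ∈ (thetaIndex (pilotDataOfK T.D T.K)).Vbad →
        (logShellsDH (pilotDataOfK T.D T.K) (analyticLogv T.K)).StarPacket v →
          Module.End ℚ ((logShellsDH (pilotDataOfK T.D T.K) (analyticLogv T.K)).StarPacket v))
      (Mmod : ℤ → ∀ j : (thetaIndex (pilotDataOfK T.D T.K)).LabelStar, Set ((logShellsDH (pilotDataOfK T.D T.K) (analyticLogv T.K)).GlobalPacket j.1))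
      (region : ℤ → ∀ j : (thetaIndex (pilotDataOfK T.D T.K)).LabelStar, FinDivisor M → ∀ vQ : (thetaIndex (pilotDataOfK T.D T.K)).VQ,
        Set ((logShellsDH (pilotDataOfK T.D T.K) (analyticLogv T.K)).Packet j.1 vQ))
      (frobAdm : ℤ → ℤ → ∀ (j : (thetaIndex (pilotDataOfK T.D T.K)).Label) (vQ : (thetaIndex (pilotDataOfK T.D T.K)).VQ),
        Set ((logShellsDH (pilotDataOfK T.D T.K) (analyticLogv T.K)).Packet j vQ) → Prop)
      (frobLogvol : ℤ → ℤ → ∀ (j : (thetaIndex (pilotDataOfK T.D T.K)).Label) (vQ : (thetaIndex (pilotDataOfK T.D T.K)).VQ),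
        Set ((logShellsDH (pilotDataOfK T.D T.K) (analyticLogv T.K)).Packet j vQ) → ℝ)
      (frobΨ : ℤ → ℤ → ∀ v : (thetaIndex (pilotDataOfK T.D T.K)).V, v ∈ (thetaIndex (pilotDataOfK T.D T.K)).Vbad →
        Set ((logShellsDH (pilotDataOfK T.D T.K) (analyticLogv T.K)).StarPacket v))
      (frobMmod : ℤ → ℤ → ∀ j : (thetaIndex (pilotDataOfK T.D T.K)).LabelStar, Set ((logShellsDH (pilotDataOfK T.D T.K) (analyticLogv T.K)).GlobalPacket j.1))
      (unitImage : ℤ → ℤ → ℕ → ∀ (j : (thetaIndex (pilotDataOfK T.D T.K)).Label) (vQ : (thetaIndex (pilotDataOfK T.D T.K)).VQ),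
        Set ((logShellsDH (pilotDataOfK T.D T.K) (analyticLogv T.K)).Packet j vQ))
      (ballImage : ℤ → ℤ → ∀ (j : (thetaIndex (pilotDataOfK T.D T.K)).Label) (vQ : (thetaIndex (pilotDataOfK T.D T.K)).VQ),
        Set ((logShellsDH (pilotDataOfK T.D T.K) (analyticLogv T.K)).Packet j vQ))
      (thetaDiv : ℤ → ℤ → LgpDivisor M (thetaIndex (pilotDataOfK T.D T.K)).lstar)
      (n : ℤ) {HT : Type} {LogLink : HT → HT → Type} {IsFull : ∀ {s t : HT}, LogLink s t → Prop}
      (lat : LGPGaussianLogThetaLattice LogLink IsFull)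
      {Frd : Type} {IsoF : Frd → Frd → Type} {Ob : Frd → Type} {realify : Frd → Frd} {Strip : Type}
      {IsoS : Strip → Strip → Type} {Mv : ∀ v : (thetaIndex (pilotDataOfK T.D T.K)).V, v ∈ (thetaIndex (pilotDataOfK T.D T.K)).Vbad → Type}
      [∀ v h, Monoid (Mv v h)]
      (sig : GlobalLGPFrobenioidSignature (thetaIndex (pilotDataOfK T.D T.K)).lstar (thetaIndex (pilotDataOfK T.D T.K)).V
        (· ∈ (thetaIndex (pilotDataOfK T.D T.K)).Vbad) Frd IsoF Ob realify Strip IsoS Mv)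
      (split : SplittingMonoids Mv) {ObΔ : Type} {N : ∀ v : (thetaIndex (pilotDataOfK T.D T.K)).V, v ∈ (thetaIndex (pilotDataOfK T.D T.K)).Vbad → Type}
      [∀ v h, Monoid (N v h)] (qData : QPilotData ObΔ N)
      (qK : ∀ v : (thetaIndex (pilotDataOfK T.D T.K)).V, v ∈ (thetaIndex (pilotDataOfK T.D T.K)).Vbad →
        Set ((logShellsDH (pilotDataOfK T.D T.K) (analyticLogv T.K)).StarPacket v)),
      ¬ Cor312Vol.PilotKummerCompatHull
          (LatticeSituation.ofShells (logShellsDH (pilotDataOfK T.D T.K) (analyticLogv T.K)) M archPk archSub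
            (summandPiecesPr (pilotDataOfK T.D T.K) (logvAnalytic_analyticLogv (F := T.K))).Adm
            (summandPiecesPr (pilotDataOfK T.D T.K) (logvAnalytic_analyticLogv (F := T.K))).logvol Ψ act Mmod region frobAdm frobLogvol frobΨ
            frobMmod unitImage ballImage thetaDiv)
          (settingPrVolSharp (pilotDataOfK T.D T.K) (logvAnalytic_analyticLogv (F := T.K)) M archPk archSub Ψ act Mmod region n lat sig split qData
            (exists_realising_qIdeles_pilotDataOfK T.D).choose (exists_realising_thetaIdeles_pilotDataOfK T.D).choose
            (exists_realising_qIdeles_pilotDataOfK T.D).choose_spec.1 (exists_realising_qIdeles_pilotDataOfK T.D).choose_spec.2.1)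
          (fun _ => Cor312.Setting.qRegion
            (settingPrVolSharp (pilotDataOfK T.D T.K) (logvAnalytic_analyticLogv (F := T.K)) M archPk archSub Ψ act Mmod region n lat sig split qData
              (exists_realising_qIdeles_pilotDataOfK T.D).choose (exists_realising_thetaIdeles_pilotDataOfK T.D).choose
              (exists_realising_qIdeles_pilotDataOfK T.D).choose_spec.1 (exists_realising_qIdeles_pilotDataOfK T.D).choose_spec.2.1)) qK := by
  classical
  letI := T.instFieldF; letI := T.instNumberFieldF; letI := T.instAlgebraF; letI := T.instFieldK
  letI := T.instNumberFieldK; letI := T.instAlgebraK; letI := T.instFieldFbar; letI := T.instAlgebraFbar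
  letI := T.instAlgebraKFbar; letI := T.instIsElliptic
  haveI : Fact (pp : ℕ).Prime := ⟨pp.2⟩
  have hp2 : (pp : ℕ) ≠ 2 := by rcases hpq with ⟨h3, -⟩ | ⟨h5, -⟩ <;> omega
  -- the pole order `h = 2t`
  set h : ℕ := 2 * t with hh_def
  have hh : 1 ≤ h := by omega
  have hord : ∀ u : HeightOneSpectrum (𝓞 ℚ), Rat.HeightOneSpectrum.natGenerator u = (pp : ℕ) → ord ℚ u (Cor22.jInv q) ≤ -(h : ℤ) :=
    fun u hu => by rw [hpole u hu, hh_def]; push_cast; exact le_rfl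
  intro M _ _ archPk archSub Ψ act Mmod region frobAdm frobLogvol frobΨ frobMmod unitImage ballImage thetaDiv n HT LogLink IsFull lat
    Frd IsoF Ob realify Strip IsoS Mv _ sig split ObΔ N _ qData qK
  obtain ⟨v, hv⟩ := (thetaIndex (pilotDataOfK T.D T.K)).fibre_nonempty (.inr pp)
  set x₀ : (thetaIndex (pilotDataOfK T.D T.K)).Fibre (.inr pp) := ⟨v, hv⟩ with hx₀def
  -- the label
  have hlstar : (thetaIndex (pilotDataOfK T.D T.K)).lstar = (l - 1) / 2 := by
    show ((pilotDataOfK T.D T.K).l - 1) / 2 = (l - 1) / 2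
    rw [pilotDataOfK_l]
  have hlt : i₀ < (thetaIndex (pilotDataOfK T.D T.K)).lstar := by rw [hlstar]; omega
  have hl5 : 5 ≤ l := T.D.five_le_l
  -- the prime
  obtain ⟨p₃, hp₃⟩ : ∃ p₃, (pp : ℕ) = p₃ + 3 := ⟨(pp : ℕ) - 3, by rcases hpq with ⟨h3, -⟩ | ⟨h5, -⟩ <;> omega⟩
  have hp2' : 2 < (pp : ℕ) := by omega
  have hp0 : (0 : ℝ) < ((pp : ℕ) : ℝ) := by exact_mod_cast pp.2.pos
  have hp1 : (1 : ℝ) < ((pp : ℕ) : ℝ) := by exact_mod_cast pp.2.one_lt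
  -- `x₀` is bad and `‖t_q(x₀)‖ ≤ p^{−h/(2l)}` (abc-iut-w4-d026)
  obtain ⟨-, hnorm⟩ := norm_chosenQIdele_le_rpow_of_ratPoint' T.D q T.j_eq T.isP5Choice pp x₀ hp2 hpl h hh hord
  -- the WILD-uniform bound on the Prop. 1.2 constants of `K_{x₀}` (`v_p(e) ≤ 1`, Hensel; this seat's `Cor312GenuineKWildDifferentUpper`)
  have hdab := GenuineK.depthConstants_kOf_le_wild_ratPoint T pp hpq hpl ht hpole hB x₀
  set e : ℕ := absRamificationIdx (pp : ℕ) (kOf (pilotDataOfK T.D T.K) pp.1 x₀) with hedef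
  have he0 : 0 < e := absRamificationIdx_pos (pp : ℕ) _
  set dab : ℝ := differentOrd (pp : ℕ) (kOf (pilotDataOfK T.D T.K) pp.1 x₀) + logRadiusA (pp : ℕ) e + logRadiusB (pp : ℕ) e with hdabdef
  have he' : (0 : ℝ) < (e : ℝ) := by exact_mod_cast he0
  have h1e : 0 < 1 / (e : ℝ) := by positivity
  have hp2r : (0 : ℝ) < ((pp : ℕ) : ℝ) - 2 := by
    have : (2 : ℝ) < ((pp : ℕ) : ℝ) := by exact_mod_cast hp2'
    linarith
  have hl0 : (0 : ℝ) < (l : ℝ) := by exact_mod_cast (show 0 < l by omega)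
  have hi0 : (0 : ℝ) < (i₀ : ℝ) + 2 := by positivity
  -- the integer test, read over `ℝ`: `(i₀+2)·(B + 2 + 1/(p−2)) + 1 ≤ (h/2l)·i₀(i₀+2)`
  have htestR : ((i₀ : ℝ) + 2) * ((B : ℝ) + 2 + 1 / (((pp : ℕ) : ℝ) - 2)) + 1 ≤
      (h : ℝ) / (2 * l) * ((i₀ : ℝ) * ((i₀ : ℝ) + 2)) := by
    have hc : (((pp : ℕ) : ℝ) - 2) = (p₃ : ℝ) + 1 := by rw [hp₃]; push_cast; ring
    have key : (2 * (l : ℝ)) * (((i₀ : ℝ) + 2) * (((B : ℝ) + 2) * ((p₃ : ℝ) + 1) + 1) + ((p₃ : ℝ) + 1)) ≤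
        (h : ℝ) * ((i₀ : ℝ) * ((i₀ : ℝ) + 2)) * ((p₃ : ℝ) + 1) := by
      have h1 : (pp : ℕ) - 2 = p₃ + 1 := by omega
      rw [h1] at htest
      exact_mod_cast htest
    rw [hc]
    rw [show ((i₀ : ℝ) + 2) * ((B : ℝ) + 2 + 1 / ((p₃ : ℝ) + 1)) + 1 =
        ((2 * (l : ℝ)) * (((i₀ : ℝ) + 2) * (((B : ℝ) + 2) * ((p₃ : ℝ) + 1) + 1) + ((p₃ : ℝ) + 1))) /
          ((2 * (l : ℝ)) * ((p₃ : ℝ) + 1)) by field_simp]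
    rw [show (h : ℝ) / (2 * l) * ((i₀ : ℝ) * ((i₀ : ℝ) + 2)) =
        ((h : ℝ) * ((i₀ : ℝ) * ((i₀ : ℝ) + 2)) * ((p₃ : ℝ) + 1)) / ((2 * (l : ℝ)) * ((p₃ : ℝ) + 1)) by field_simp]
    exact div_le_div_of_nonneg_right key (by positivity)
  -- the exponent: `(i₀+2)·dab + 1 < (h/2l)·((i₀+1)²−1)`
  have hA : ((i₀ : ℝ) + 2) * dab + 1 < (h : ℝ) / (2 * l) * ((i₀ : ℝ) * ((i₀ : ℝ) + 2)) := by
    have h1 : ((i₀ : ℝ) + 2) * dab ≤ ((i₀ : ℝ) + 2) * ((B : ℝ) + 2 + 1 / (((pp : ℕ) : ℝ) - 2) - 1 / (e : ℝ)) :=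
      mul_le_mul_of_nonneg_left hdab hi0.le
    nlinarith [mul_pos hi0 h1e]
  -- assemble `hdeep`
  set τ : ℝ := ‖(exists_realising_qIdeles_pilotDataOfK T.D).choose pp x₀‖ with hτdef
  have hτ0 : 0 ≤ τ := norm_nonneg _
  have hn : (i₀ + 1) ^ 2 - 1 = i₀ * (i₀ + 2) := by
    have : (i₀ + 1) ^ 2 = i₀ * (i₀ + 2) + 1 := by ring
    omega
  have hpow : τ ^ ((i₀ + 1) ^ 2 - 1) ≤ ((pp : ℕ) : ℝ) ^ ((-(h : ℝ) / (2 * l)) * ((i₀ : ℝ) * ((i₀ : ℝ) + 2))) := by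
    rw [hn]
    calc τ ^ (i₀ * (i₀ + 2)) ≤ ((((pp : ℕ) : ℝ)) ^ (-(h : ℝ) / (2 * l))) ^ (i₀ * (i₀ + 2)) := pow_le_pow_left₀ hτ0 hnorm _
      _ = ((pp : ℕ) : ℝ) ^ ((-(h : ℝ) / (2 * l)) * ((i₀ : ℝ) * ((i₀ : ℝ) + 2))) := by
          rw [← Real.rpow_natCast, ← Real.rpow_mul hp0.le]
          push_cast
          ring_nf
  have hdeep : ((pp : ℕ) : ℝ) ^ ((((i₀ : ℕ) : ℝ) + 2) * dab + 1) * τ ^ (((i₀ : ℕ) + 1) ^ 2 - 1) < 1 := by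
    have hApos : 0 < ((pp : ℕ) : ℝ) ^ ((((i₀ : ℕ) : ℝ) + 2) * dab + 1) := Real.rpow_pos_of_pos hp0 _
    calc ((pp : ℕ) : ℝ) ^ ((((i₀ : ℕ) : ℝ) + 2) * dab + 1) * τ ^ (((i₀ : ℕ) + 1) ^ 2 - 1)
        ≤ ((pp : ℕ) : ℝ) ^ ((((i₀ : ℕ) : ℝ) + 2) * dab + 1) *
            ((pp : ℕ) : ℝ) ^ ((-(h : ℝ) / (2 * l)) * ((i₀ : ℝ) * ((i₀ : ℝ) + 2))) := mul_le_mul_of_nonneg_left hpow hApos.le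
      _ = ((pp : ℕ) : ℝ) ^ ((((i₀ : ℕ) : ℝ) + 2) * dab + 1 + (-(h : ℝ) / (2 * l)) * ((i₀ : ℝ) * ((i₀ : ℝ) + 2))) :=
          (Real.rpow_add hp0 _ _).symm
      _ < ((pp : ℕ) : ℝ) ^ (0 : ℝ) := by
          apply Real.rpow_lt_rpow_of_exponent_lt hp1
          have : (-(h : ℝ) / (2 * l)) * ((i₀ : ℝ) * ((i₀ : ℝ) + 2)) = -((h : ℝ) / (2 * l) * ((i₀ : ℝ) * ((i₀ : ℝ) + 2))) := by ring
          rw [this]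
          linarith
      _ = 1 := Real.rpow_zero _
  exact GenuineK.not_pilotKummerCompatHull_chosen_of_explicit_depth T.D M archPk archSub Ψ act Mmod region frobAdm frobLogvol frobΨ
    frobMmod unitImage ballImage thetaDiv n lat sig split qData qK pp ⟨i₀, hlt⟩ x₀ hdeep


/-- **abc-TRIPLE form at a wild pole prime.** `a + b = c` coprime, `λ = a/c`, `{p, p′} = {3, 5}`, `p ≠ l`, `p^v ∥ abc` (`v ≥ 1`; the pole order of
`j(λ)` at `p` is exactly `2v`, abc-iut-W-neg-1's `RadTriple.ord_jInv_eq_neg_two_mul`), `B` with `p·p′·l < p^B`, a label `i₀ + 1 ≤ l⋆` with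
**`2l·((i₀+2)·((B+2)(p−2)+1) + (p−2)) ≤ 2v·i₀(i₀+2)·(p−2)`** ⇒ ¬ S_H at every genuine Θ-volume datum over `(ratPoint (a/c), l)` — unconditionally,
whatever the local type at `p`. [cite: MochizukiGenEll2010, Thm. 2.1 p. 11] [cite: Mochizuki2012, IUTchIV Cor. 2.2 (ii) proof p. 44; IUTchIII Cor. 3.12 Step (xi-f) p. 184]
[claim: Mochizuki2012, status: disputed] -/
theorem GenuineK.not_pilotKummerCompatHull_chosen_triple_of_linUniform_wild {a b c : ℕ} (habc : IsABCTriple a b c) {l : ℕ}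
    (T : Cor22.ThetaVolumeDatumAt (ratPoint ((a : ℚ) / c)) l) (pp : Nat.Primes) {p' : ℕ}
    (hpq : ((pp : ℕ) = 3 ∧ p' = 5) ∨ ((pp : ℕ) = 5 ∧ p' = 3)) (hpl : (pp : ℕ) ≠ l)
    (B : ℕ) (hB : (pp : ℕ) * p' * l < (pp : ℕ) ^ B) (v : ℕ) (hv : 1 ≤ v)
    (hdvd : (pp : ℕ) ^ v ∣ a * b * c) (hndvd : ¬ (pp : ℕ) ^ (v + 1) ∣ a * b * c) (i₀ : ℕ) (hil : i₀ + 1 ≤ (l - 1) / 2)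
    (htest : 2 * l * ((i₀ + 2) * ((B + 2) * ((pp : ℕ) - 2) + 1) + ((pp : ℕ) - 2)) ≤ 2 * v * (i₀ * (i₀ + 2)) * ((pp : ℕ) - 2)) :
    letI := T.instFieldF; letI := T.instNumberFieldF; letI := T.instAlgebraF; letI := T.instFieldK
    letI := T.instNumberFieldK; letI := T.instAlgebraK; letI := T.instFieldFbar; letI := T.instAlgebraFbar
    letI := T.instAlgebraKFbar; letI := T.instIsElliptic
    ∀ (M : Type) [Field M] [NumberField M]
      (archPk : ∀ (j : (thetaIndex (pilotDataOfK T.D T.K)).Label) (vQ : (thetaIndex (pilotDataOfK T.D T.K)).VQ),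
        Set ((logShellsDH (pilotDataOfK T.D T.K) (analyticLogv T.K)).Packet j vQ))
      (archSub : ∀ (j : (thetaIndex (pilotDataOfK T.D T.K)).Label) (v : (thetaIndex (pilotDataOfK T.D T.K)).V),
        Set ((logShellsDH (pilotDataOfK T.D T.K) (analyticLogv T.K)).Packet j ((thetaIndex (pilotDataOfK T.D T.K)).over v)))
      (Ψ : ℤ → ∀ v : (thetaIndex (pilotDataOfK T.D T.K)).V, v ∈ (thetaIndex (pilotDataOfK T.D T.K)).Vbad →
        Set ((logShellsDH (pilotDataOfK T.D T.K) (analyticLogv T.K)).StarPacket v))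
      (act : ℤ → ∀ v : (thetaIndex (pilotDataOfK T.D T.K)).V, v ∈ (thetaIndex (pilotDataOfK T.D T.K)).Vbad →
        (logShellsDH (pilotDataOfK T.D T.K) (analyticLogv T.K)).StarPacket v →
          Module.End ℚ ((logShellsDH (pilotDataOfK T.D T.K) (analyticLogv T.K)).StarPacket v))
      (Mmod : ℤ → ∀ j : (thetaIndex (pilotDataOfK T.D T.K)).LabelStar, Set ((logShellsDH (pilotDataOfK T.D T.K) (analyticLogv T.K)).GlobalPacket j.1))
      (region : ℤ → ∀ j : (thetaIndex (pilotDataOfK T.D T.K)).LabelStar, FinDivisor M → ∀ vQ : (thetaIndex (pilotDataOfK T.D T.K)).VQ,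
        Set ((logShellsDH (pilotDataOfK T.D T.K) (analyticLogv T.K)).Packet j.1 vQ))
      (frobAdm : ℤ → ℤ → ∀ (j : (thetaIndex (pilotDataOfK T.D T.K)).Label) (vQ : (thetaIndex (pilotDataOfK T.D T.K)).VQ),
        Set ((logShellsDH (pilotDataOfK T.D T.K) (analyticLogv T.K)).Packet j vQ) → Prop)
      (frobLogvol : ℤ → ℤ → ∀ (j : (thetaIndex (pilotDataOfK T.D T.K)).Label) (vQ : (thetaIndex (pilotDataOfK T.D T.K)).VQ),
        Set ((logShellsDH (pilotDataOfK T.D T.K) (analyticLogv T.K)).Packet j vQ) → ℝ)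
      (frobΨ : ℤ → ℤ → ∀ v : (thetaIndex (pilotDataOfK T.D T.K)).V, v ∈ (thetaIndex (pilotDataOfK T.D T.K)).Vbad →
        Set ((logShellsDH (pilotDataOfK T.D T.K) (analyticLogv T.K)).StarPacket v))
      (frobMmod : ℤ → ℤ → ∀ j : (thetaIndex (pilotDataOfK T.D T.K)).LabelStar, Set ((logShellsDH (pilotDataOfK T.D T.K) (analyticLogv T.K)).GlobalPacket j.1))
      (unitImage : ℤ → ℤ → ℕ → ∀ (j : (thetaIndex (pilotDataOfK T.D T.K)).Label) (vQ : (thetaIndex (pilotDataOfK T.D T.K)).VQ),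
        Set ((logShellsDH (pilotDataOfK T.D T.K) (analyticLogv T.K)).Packet j vQ))
      (ballImage : ℤ → ℤ → ∀ (j : (thetaIndex (pilotDataOfK T.D T.K)).Label) (vQ : (thetaIndex (pilotDataOfK T.D T.K)).VQ),
        Set ((logShellsDH (pilotDataOfK T.D T.K) (analyticLogv T.K)).Packet j vQ))
      (thetaDiv : ℤ → ℤ → LgpDivisor M (thetaIndex (pilotDataOfK T.D T.K)).lstar)
      (n : ℤ) {HT : Type} {LogLink : HT → HT → Type} {IsFull : ∀ {s t : HT}, LogLink s t → Prop}
      (lat : LGPGaussianLogThetaLattice LogLink IsFull)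
      {Frd : Type} {IsoF : Frd → Frd → Type} {Ob : Frd → Type} {realify : Frd → Frd} {Strip : Type}
      {IsoS : Strip → Strip → Type} {Mv : ∀ v : (thetaIndex (pilotDataOfK T.D T.K)).V, v ∈ (thetaIndex (pilotDataOfK T.D T.K)).Vbad → Type}
      [∀ v h, Monoid (Mv v h)]
      (sig : GlobalLGPFrobenioidSignature (thetaIndex (pilotDataOfK T.D T.K)).lstar (thetaIndex (pilotDataOfK T.D T.K)).V
        (· ∈ (thetaIndex (pilotDataOfK T.D T.K)).Vbad) Frd IsoF Ob realify Strip IsoS Mv)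
      (split : SplittingMonoids Mv) {ObΔ : Type} {N : ∀ v : (thetaIndex (pilotDataOfK T.D T.K)).V, v ∈ (thetaIndex (pilotDataOfK T.D T.K)).Vbad → Type}
      [∀ v h, Monoid (N v h)] (qData : QPilotData ObΔ N)
      (qK : ∀ v : (thetaIndex (pilotDataOfK T.D T.K)).V, v ∈ (thetaIndex (pilotDataOfK T.D T.K)).Vbad →
        Set ((logShellsDH (pilotDataOfK T.D T.K) (analyticLogv T.K)).StarPacket v)),
      ¬ Cor312Vol.PilotKummerCompatHull
          (LatticeSituation.ofShells (logShellsDH (pilotDataOfK T.D T.K) (analyticLogv T.K)) M archPk archSub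
            (summandPiecesPr (pilotDataOfK T.D T.K) (logvAnalytic_analyticLogv (F := T.K))).Adm
            (summandPiecesPr (pilotDataOfK T.D T.K) (logvAnalytic_analyticLogv (F := T.K))).logvol Ψ act Mmod region frobAdm frobLogvol frobΨ
            frobMmod unitImage ballImage thetaDiv)
          (settingPrVolSharp (pilotDataOfK T.D T.K) (logvAnalytic_analyticLogv (F := T.K)) M archPk archSub Ψ act Mmod region n lat sig split qData
            (exists_realising_qIdeles_pilotDataOfK T.D).choose (exists_realising_thetaIdeles_pilotDataOfK T.D).choose
            (exists_realising_qIdeles_pilotDataOfK T.D).choose_spec.1 (exists_realising_qIdeles_pilotDataOfK T.D).choose_spec.2.1)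
          (fun _ => Cor312.Setting.qRegion
            (settingPrVolSharp (pilotDataOfK T.D T.K) (logvAnalytic_analyticLogv (F := T.K)) M archPk archSub Ψ act Mmod region n lat sig split qData
              (exists_realising_qIdeles_pilotDataOfK T.D).choose (exists_realising_thetaIdeles_pilotDataOfK T.D).choose
              (exists_realising_qIdeles_pilotDataOfK T.D).choose_spec.1 (exists_realising_qIdeles_pilotDataOfK T.D).choose_spec.2.1)) qK := by
  have hp2 : (pp : ℕ) ≠ 2 := by rcases hpq with ⟨h3, -⟩ | ⟨h5, -⟩ <;> omega
  exact GenuineK.not_pilotKummerCompatHull_chosen_ratPoint_of_linUniform_wild T pp hpq hpl B hB hv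
    (RadTriple.ord_jInv_eq_neg_two_mul habc pp.2 hp2 hv hdvd hndvd) i₀ hil htest

end Summit.ABC.IUTFork.Conditional

end
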